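import Summits.AtomisticToContinuum.FouriersLaw.Theorems.EmbeddedDrudeMourreDrudeDissolutionStubPencilDerivationAlgebra
import Literature.MathematicalPhysics.KineticTheory.HarmonicChaosDecomposition
import Literature.MathematicalPhysics.KineticTheory.InfiniteChainInvariantStates
import HarnessLib

/-!
# The Liouville operator on products of linear observables
(helper file of stub `stub_harmonicStein` (K1) of line `gram-pencil-harmonic-chaos`, crux
`EmbeddedDrudeMourre.DrudeDissolution`, item stmt-AtomisticToContinuum-12593; `--supports` file,
closes nothing; registered helper theorem `harmonicStein_liouvilleProd`)

WHAT. Elementary calculus of the linear local observables `φ(f) = Σ_x (f^q_x q_x + f^p_x p_x)`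
(`HarmonicChaos.linObs`) of the infinite chain, for an ARBITRARY chain `P`:
* `linObs_update`, `hasDerivAt_linObs_lineQ/lineP` — `φ(f)` is affine along every coordinate line,
  with slopes `f^q_y`, `f^p_y`; `linObs_mem_localPolynomials` — `φ(f)` is a local polynomial;
* `partialQZ_prod`, `partialPZ_prod` — the coordinate derivatives of a finite product (Leibniz);
* `liouvilleZ_eq_sum_of_hasDerivAt`, `liouvilleZ_mul_eq`, `liouvilleZ_prod_eq` — the Liouville
  operator `𝒜 = Σ_y (p_y ∂_{q_y} + F_y ∂_{p_y})` of an observable (a product of observables)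
  differentiable along the coordinate lines with finitely supported slopes is the corresponding
  FINITE sum (Leibniz rule for products);
* `liouvilleZ_linObs`, `liouvilleZ_prod_linObs` (= `harmonicStein_liouvilleProd`) — in particular
  `𝒜 ∏ᵢ φ(fᵢ) = Σᵢ (∏_{j ≠ i} φ(f_j)) · Σ_y (p_y f_i^q(y) + F_y f_i^p(y))`, and
  `liouvilleZ_snd_mul_prod_linObs` — `𝒜(p_x Π) = F_x Π + p_x 𝒜Π`;
* `force_update_snd` — the forces do not read the momenta.

HOW. Mathlib's `HasDerivAt.fun_finsetProd` and `tsum_eq_sum`.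
-/

noncomputable section

namespace Summit.AtomisticToContinuum.FouriersLaw.Theorems.DrudeDissolution.GramPencilHarmonicChaos

open MeasureTheory Filter Set Function Topology
open Literature.MathematicalPhysics.KineticTheory
open Literature.MathematicalPhysics.KineticTheory.HeatConduction
open HarmonicChaos

/-! ## Linear observables: update formula, line derivatives, polynomiality -/

/-- `φ(f)` as a finite sum over the supports. [folklore] -/
theorem linObs_eq_sum (f : TestFn) (σ : ChainConfig) :
    linObs f σ = ∑ x ∈ f.1.support, f.1 x * (σ x).1 + ∑ x ∈ f.2.support, f.2 x * (σ x).2 := rfl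

/-- **Update formula**: `φ(f)(σ[y ↦ v]) = φ(f)(σ) + f^q_y (v₁ − q_y) + f^p_y (v₂ − p_y)`. [folklore] -/
theorem linObs_update (f : TestFn) (σ : ChainConfig) (y : ℤ) (v : ℝ × ℝ) :
    linObs f (update σ y v) = linObs f σ + f.1 y * (v.1 - (σ y).1) + f.2 y * (v.2 - (σ y).2) := by
  rw [linObs_eq_sum, linObs_eq_sum]
  have h1 : ∑ x ∈ f.1.support, f.1 x * (update σ y v x).1 =
      ∑ x ∈ f.1.support, f.1 x * (σ x).1 + f.1 y * (v.1 - (σ y).1) := by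
    have : ∀ x ∈ f.1.support, f.1 x * (update σ y v x).1 =
        f.1 x * (σ x).1 + (if x = y then f.1 x * (v.1 - (σ y).1) else 0) := by
      intro x _
      by_cases hx : x = y
      · subst hx; simp; ring
      · simp [hx]
    rw [Finset.sum_congr rfl this, Finset.sum_add_distrib, Finset.sum_ite_eq']
    by_cases hy : y ∈ f.1.support
    · rw [if_pos hy]
    · rw [if_neg hy, Finsupp.notMem_support_iff.1 hy]; ring
  have h2 : ∑ x ∈ f.2.support, f.2 x * (update σ y v x).2 =
      ∑ x ∈ f.2.support, f.2 x * (σ x).2 + f.2 y * (v.2 - (σ y).2) := by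
    have : ∀ x ∈ f.2.support, f.2 x * (update σ y v x).2 =
        f.2 x * (σ x).2 + (if x = y then f.2 x * (v.2 - (σ y).2) else 0) := by
      intro x _
      by_cases hx : x = y
      · subst hx; simp; ring
      · simp [hx]
    rw [Finset.sum_congr rfl this, Finset.sum_add_distrib, Finset.sum_ite_eq']
    by_cases hy : y ∈ f.2.support
    · rw [if_pos hy]
    · rw [if_neg hy, Finsupp.notMem_support_iff.1 hy]; ring
  rw [h1, h2]
  ring

/-- `φ(f)` is affine along the `q_y`-line, with slope `f^q_y`. [folklore] -/
theorem hasDerivAt_linObs_lineQ (f : TestFn) (σ : ChainConfig) (y : ℤ) (t₀ : ℝ) :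
    HasDerivAt (fun t => linObs f (update σ y (t, (σ y).2))) (f.1 y) t₀ := by
  have h : (fun t => linObs f (update σ y (t, (σ y).2))) =
      fun t => f.1 y * t + (linObs f σ - f.1 y * (σ y).1) := by
    funext t; rw [linObs_update]; ring
  rw [h]
  simpa using (hasDerivAt_const_mul (f.1 y) (x := t₀)).add_const (linObs f σ - f.1 y * (σ y).1)

/-- `φ(f)` is affine along the `p_y`-line, with slope `f^p_y`. [folklore] -/
theorem hasDerivAt_linObs_lineP (f : TestFn) (σ : ChainConfig) (y : ℤ) (t₀ : ℝ) :
    HasDerivAt (fun t => linObs f (update σ y ((σ y).1, t))) (f.2 y) t₀ := by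
  have h : (fun t => linObs f (update σ y ((σ y).1, t))) =
      fun t => f.2 y * t + (linObs f σ - f.2 y * (σ y).2) := by
    funext t; rw [linObs_update]; ring
  rw [h]
  simpa using (hasDerivAt_const_mul (f.2 y) (x := t₀)).add_const (linObs f σ - f.2 y * (σ y).2)

/-- `φ(f)` is a local polynomial. [folklore] -/
theorem linObs_mem_localPolynomials (f : TestFn) :
    linObs f ∈ Algebra.adjoin ℝ (Set.range (fun xc : ℤ × Bool => fun σ : ChainConfig =>
      if xc.2 then (σ xc.1).2 else (σ xc.1).1)) := by
  set A := Algebra.adjoin ℝ (Set.range (fun xc : ℤ × Bool => fun σ : ChainConfig =>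
      if xc.2 then (σ xc.1).2 else (σ xc.1).1)) with hA
  have h : linObs f = ∑ x ∈ f.1.support, f.1 x • (fun σ : ChainConfig => (σ x).1) +
      ∑ x ∈ f.2.support, f.2 x • (fun σ : ChainConfig => (σ x).2) := by
    funext σ
    simp only [linObs_eq_sum, Pi.add_apply, Finset.sum_apply, Pi.smul_apply, smul_eq_mul]
  rw [h]
  exact A.add_mem (A.sum_mem fun x _ => A.smul_mem (position_mem_localPolynomials x) _)
    (A.sum_mem fun x _ => A.smul_mem (momentum_mem_localPolynomials x) _)

/-- Products of linear observables are local polynomials. [folklore] -/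
theorem prod_linObs_mem_localPolynomials {ι : Type*} (u : Finset ι) (f : ι → TestFn) :
    (fun σ : ChainConfig => ∏ i ∈ u, linObs (f i) σ) ∈ Algebra.adjoin ℝ (Set.range
      (fun xc : ℤ × Bool => fun σ : ChainConfig => if xc.2 then (σ xc.1).2 else (σ xc.1).1)) := by
  have h : (fun σ : ChainConfig => ∏ i ∈ u, linObs (f i) σ) = ∏ i ∈ u, linObs (f i) := by
    funext σ; simp [Finset.prod_apply]
  rw [h]
  exact Subalgebra.prod_mem _ fun i _ => linObs_mem_localPolynomials (f i)

/-! ## Coordinates along coordinate lines; the forces do not read the momenta -/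

/-- Positions are unchanged when a momentum is updated. [folklore] -/
theorem fst_update_snd (σ : ChainConfig) (x : ℤ) (t : ℝ) (z : ℤ) :
    (update σ x ((σ x).1, t) z).1 = (σ z).1 := by
  by_cases h : z = x
  · subst h; simp
  · rw [update_of_ne h]

/-- **The forces do not read the momenta**: `F_y(σ[p_x ↦ t]) = F_y(σ)`. [folklore] -/
theorem force_update_snd (P : OscillatorChain) (σ : ChainConfig) (x : ℤ) (t : ℝ) (y : ℤ) :
    P.force (update σ x ((σ x).1, t)) y = P.force σ y := by
  simp only [OscillatorChain.force_eq, fst_update_snd]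

/-- The momentum `p_x` is constant along every `q_y`-line. [folklore] -/
theorem hasDerivAt_snd_lineQ (σ : ChainConfig) (x y : ℤ) (t₀ : ℝ) :
    HasDerivAt (fun t : ℝ => (update σ y (t, (σ y).2) x).2) 0 t₀ := by
  have h : (fun t : ℝ => (update σ y (t, (σ y).2) x).2) = fun _ => (σ x).2 := by
    funext t
    by_cases hx : x = y
    · subst hx; simp
    · rw [update_of_ne hx]
  rw [h]
  exact hasDerivAt_const _ _

/-- The momentum `p_x` along the `p_y`-line has slope `[x = y]`. [folklore] -/
theorem hasDerivAt_snd_lineP (σ : ChainConfig) (x y : ℤ) (t₀ : ℝ) :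
    HasDerivAt (fun t : ℝ => (update σ y ((σ y).1, t) x).2) (if y = x then 1 else 0) t₀ := by
  by_cases hx : y = x
  · subst hx
    simp only [update_self, if_true]
    exact hasDerivAt_id t₀
  · have h : (fun t : ℝ => (update σ y ((σ y).1, t) x).2) = fun _ => (σ x).2 := by
      funext t; rw [update_of_ne (Ne.symm hx)]
    rw [h, if_neg hx]
    exact hasDerivAt_const _ _

/-! ## Coordinate derivatives and the Liouville operator of products -/

/-- **Leibniz rule for `∂_{q_y}` on a finite product** of observables differentiable along the
`q_y`-line. [folklore] -/
theorem partialQZ_prod {ι : Type*} [DecidableEq ι] (u : Finset ι) (g : ι → ChainConfig → ℝ)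
    (d : ι → ℝ) (y : ℤ) (σ : ChainConfig)
    (hg : ∀ i ∈ u, HasDerivAt (fun t => g i (update σ y (t, (σ y).2))) (d i) (σ y).1) :
    partialQZ y (fun σ => ∏ i ∈ u, g i σ) σ = ∑ i ∈ u, (∏ j ∈ u.erase i, g j σ) * d i := by
  unfold partialQZ
  rw [(HasDerivAt.fun_finsetProd hg).deriv]
  refine Finset.sum_congr rfl fun i _ => ?_
  rw [smul_eq_mul, Prod.mk.eta, update_eq_self]

/-- **Leibniz rule for `∂_{p_y}` on a finite product** of observables differentiable along the
`p_y`-line. [folklore] -/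
theorem partialPZ_prod {ι : Type*} [DecidableEq ι] (u : Finset ι) (g : ι → ChainConfig → ℝ)
    (d : ι → ℝ) (y : ℤ) (σ : ChainConfig)
    (hg : ∀ i ∈ u, HasDerivAt (fun t => g i (update σ y ((σ y).1, t))) (d i) (σ y).2) :
    partialPZ y (fun σ => ∏ i ∈ u, g i σ) σ = ∑ i ∈ u, (∏ j ∈ u.erase i, g j σ) * d i := by
  unfold partialPZ
  rw [(HasDerivAt.fun_finsetProd hg).deriv]
  refine Finset.sum_congr rfl fun i _ => ?_
  rw [smul_eq_mul, Prod.mk.eta, update_eq_self]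

/-- **The Liouville operator of an observable with finitely supported line derivatives is a
finite sum**: `𝒜g(σ) = Σ_{y ∈ S} (p_y ∂_{q_y}g + F_y ∂_{p_y}g)` (any chain `P`). [folklore] -/
theorem liouvilleZ_eq_sum_of_hasDerivAt (P : OscillatorChain) (g : ChainConfig → ℝ)
    (dQ dP : ℤ → ℝ) (S : Finset ℤ) (σ : ChainConfig)
    (hQ : ∀ y, HasDerivAt (fun t => g (update σ y (t, (σ y).2))) (dQ y) (σ y).1)
    (hP : ∀ y, HasDerivAt (fun t => g (update σ y ((σ y).1, t))) (dP y) (σ y).2)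
    (hS : ∀ y ∉ S, dQ y = 0 ∧ dP y = 0) :
    liouvilleZ P g σ = ∑ y ∈ S, ((σ y).2 * dQ y + P.force σ y * dP y) := by
  unfold liouvilleZ partialQZ partialPZ
  simp_rw [fun y => (hQ y).deriv, fun y => (hP y).deriv]
  refine tsum_eq_sum fun y hy => ?_
  rw [(hS y hy).1, (hS y hy).2, mul_zero, mul_zero, add_zero]

/-- **Leibniz rule for the Liouville operator on a product of two observables** with finitely
supported line derivatives: `𝒜(gh) = g 𝒜h + h 𝒜g` (any chain `P`). [folklore] -/
theorem liouvilleZ_mul_eq (P : OscillatorChain) (g h : ChainConfig → ℝ)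
    (dQg dPg dQh dPh : ℤ → ℝ) (S : Finset ℤ) (σ : ChainConfig)
    (hQg : ∀ y, HasDerivAt (fun t => g (update σ y (t, (σ y).2))) (dQg y) (σ y).1)
    (hPg : ∀ y, HasDerivAt (fun t => g (update σ y ((σ y).1, t))) (dPg y) (σ y).2)
    (hQh : ∀ y, HasDerivAt (fun t => h (update σ y (t, (σ y).2))) (dQh y) (σ y).1)
    (hPh : ∀ y, HasDerivAt (fun t => h (update σ y ((σ y).1, t))) (dPh y) (σ y).2)
    (hSg : ∀ y ∉ S, dQg y = 0 ∧ dPg y = 0) (hSh : ∀ y ∉ S, dQh y = 0 ∧ dPh y = 0) :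
    liouvilleZ P (fun σ => g σ * h σ) σ = g σ * liouvilleZ P h σ + h σ * liouvilleZ P g σ := by
  have hQ : ∀ y, HasDerivAt (fun t => g (update σ y (t, (σ y).2)) * h (update σ y (t, (σ y).2)))
      (dQg y * h σ + g σ * dQh y) (σ y).1 := by
    intro y
    have := (hQg y).mul (hQh y)
    simp only [Prod.mk.eta, update_eq_self] at this
    exact this
  have hP : ∀ y, HasDerivAt (fun t => g (update σ y ((σ y).1, t)) * h (update σ y ((σ y).1, t)))
      (dPg y * h σ + g σ * dPh y) (σ y).2 := by
    intro y
    have := (hPg y).mul (hPh y)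
    simp only [Prod.mk.eta, update_eq_self] at this
    exact this
  rw [liouvilleZ_eq_sum_of_hasDerivAt P (fun σ => g σ * h σ) _ _ S σ hQ hP (fun y hy => by
      rw [(hSg y hy).1, (hSg y hy).2, (hSh y hy).1, (hSh y hy).2]; simp),
    liouvilleZ_eq_sum_of_hasDerivAt P g dQg dPg S σ hQg hPg hSg,
    liouvilleZ_eq_sum_of_hasDerivAt P h dQh dPh S σ hQh hPh hSh, Finset.mul_sum, Finset.mul_sum,
    ← Finset.sum_add_distrib]
  refine Finset.sum_congr rfl fun y _ => ?_
  ring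

/-- **Leibniz rule for the Liouville operator on a finite product** of observables with finitely
supported line derivatives: `𝒜 ∏ᵢ gᵢ = Σᵢ (∏_{j ≠ i} g_j) 𝒜gᵢ`, with `𝒜gᵢ` written as the finite sum
`Σ_{y ∈ S} (p_y ∂_{q_y}gᵢ + F_y ∂_{p_y}gᵢ)` (any chain `P`). [folklore] -/
theorem liouvilleZ_prod_eq (P : OscillatorChain) {ι : Type*} [DecidableEq ι] (u : Finset ι)
    (g : ι → ChainConfig → ℝ) (dQ dP : ι → ℤ → ℝ) (S : Finset ℤ) (σ : ChainConfig)
    (hQ : ∀ i ∈ u, ∀ y, HasDerivAt (fun t => g i (update σ y (t, (σ y).2))) (dQ i y) (σ y).1)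
    (hP : ∀ i ∈ u, ∀ y, HasDerivAt (fun t => g i (update σ y ((σ y).1, t))) (dP i y) (σ y).2)
    (hS : ∀ i ∈ u, ∀ y ∉ S, dQ i y = 0 ∧ dP i y = 0) :
    liouvilleZ P (fun σ => ∏ i ∈ u, g i σ) σ =
      ∑ i ∈ u, (∏ j ∈ u.erase i, g j σ) * ∑ y ∈ S, ((σ y).2 * dQ i y + P.force σ y * dP i y) := by
  unfold liouvilleZ
  have hq : ∀ y, partialQZ y (fun σ => ∏ i ∈ u, g i σ) σ = ∑ i ∈ u, (∏ j ∈ u.erase i, g j σ) * dQ i y :=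
    fun y => partialQZ_prod u g (fun i => dQ i y) y σ (fun i hi => hQ i hi y)
  have hp : ∀ y, partialPZ y (fun σ => ∏ i ∈ u, g i σ) σ = ∑ i ∈ u, (∏ j ∈ u.erase i, g j σ) * dP i y :=
    fun y => partialPZ_prod u g (fun i => dP i y) y σ (fun i hi => hP i hi y)
  simp_rw [hq, hp]
  rw [tsum_eq_sum (s := S)]
  · have h1 : ∀ y ∈ S, (σ y).2 * ∑ i ∈ u, (∏ j ∈ u.erase i, g j σ) * dQ i y +
        P.force σ y * ∑ i ∈ u, (∏ j ∈ u.erase i, g j σ) * dP i y =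
        ∑ i ∈ u, (∏ j ∈ u.erase i, g j σ) * ((σ y).2 * dQ i y + P.force σ y * dP i y) := by
      intro y _
      rw [Finset.mul_sum, Finset.mul_sum, ← Finset.sum_add_distrib]
      refine Finset.sum_congr rfl fun i _ => ?_
      ring
    rw [Finset.sum_congr rfl h1, Finset.sum_comm]
    refine Finset.sum_congr rfl fun i _ => ?_
    rw [Finset.mul_sum]
  · intro y hy
    have h0 : ∀ i ∈ u, (∏ j ∈ u.erase i, g j σ) * dQ i y = 0 := fun i hi => by
      rw [(hS i hi y hy).1, mul_zero]
    have h0' : ∀ i ∈ u, (∏ j ∈ u.erase i, g j σ) * dP i y = 0 := fun i hi => by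
      rw [(hS i hi y hy).2, mul_zero]
    rw [Finset.sum_eq_zero h0, Finset.sum_eq_zero h0', mul_zero, mul_zero, add_zero]

/-! ## The Liouville operator of (products of) linear observables -/

/-- Off the supports the slopes of `φ(f)` vanish. [folklore] -/
theorem linObs_slopes_eq_zero (f : TestFn) {S : Finset ℤ} (hS : f.1.support ∪ f.2.support ⊆ S)
    {y : ℤ} (hy : y ∉ S) : f.1 y = 0 ∧ f.2 y = 0 := by
  constructor
  · exact Finsupp.notMem_support_iff.1 fun h => hy (hS (Finset.mem_union_left _ h))
  · exact Finsupp.notMem_support_iff.1 fun h => hy (hS (Finset.mem_union_right _ h))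

/-- **`𝒜φ(f) = Σ_y (p_y f^q_y + F_y f^p_y)`** (finite sum over any `S` containing the supports;
any chain `P`). [folklore] -/
theorem liouvilleZ_linObs (P : OscillatorChain) (f : TestFn) (S : Finset ℤ)
    (hS : f.1.support ∪ f.2.support ⊆ S) (σ : ChainConfig) :
    liouvilleZ P (linObs f) σ = ∑ y ∈ S, ((σ y).2 * f.1 y + P.force σ y * f.2 y) :=
  liouvilleZ_eq_sum_of_hasDerivAt P (linObs f) f.1 f.2 S σ
    (fun y => hasDerivAt_linObs_lineQ f σ y _) (fun y => hasDerivAt_linObs_lineP f σ y _)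
    (fun _ hy => linObs_slopes_eq_zero f hS hy)

/-- **`𝒜 ∏ᵢ φ(fᵢ) = Σᵢ (∏_{j ≠ i} φ(f_j)) 𝒜φ(fᵢ)`**, with `𝒜φ(fᵢ) = Σ_{y ∈ S} (p_y f_i^q(y) + F_y f_i^p(y))`
(any chain `P`, any `S` containing all supports). [folklore] -/
theorem liouvilleZ_prod_linObs (P : OscillatorChain) {ι : Type*} [DecidableEq ι] (u : Finset ι)
    (f : ι → TestFn) (S : Finset ℤ) (hS : ∀ i ∈ u, (f i).1.support ∪ (f i).2.support ⊆ S)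
    (σ : ChainConfig) :
    liouvilleZ P (fun σ => ∏ i ∈ u, linObs (f i) σ) σ =
      ∑ i ∈ u, (∏ j ∈ u.erase i, linObs (f j) σ) *
        ∑ y ∈ S, ((σ y).2 * (f i).1 y + P.force σ y * (f i).2 y) :=
  liouvilleZ_prod_eq P u (fun i => linObs (f i)) (fun i => (f i).1) (fun i => (f i).2) S σ
    (fun i _ y => hasDerivAt_linObs_lineQ (f i) σ y _)
    (fun i _ y => hasDerivAt_linObs_lineP (f i) σ y _)
    (fun i hi _ hy => linObs_slopes_eq_zero (f i) (hS i hi) hy)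

/-- **`𝒜(p_x ∏ᵢ φ(fᵢ)) = F_x ∏ᵢ φ(fᵢ) + p_x 𝒜 ∏ᵢ φ(fᵢ)`** (any chain `P`). [folklore] -/
theorem liouvilleZ_snd_mul_prod_linObs (P : OscillatorChain) {ι : Type*} [DecidableEq ι]
    (u : Finset ι) (f : ι → TestFn) (x : ℤ) (S : Finset ℤ) (hx : x ∈ S)
    (hS : ∀ i ∈ u, (f i).1.support ∪ (f i).2.support ⊆ S) (σ : ChainConfig) :
    liouvilleZ P (fun σ => (σ x).2 * ∏ i ∈ u, linObs (f i) σ) σ =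
      P.force σ x * ∏ i ∈ u, linObs (f i) σ +
        (σ x).2 * liouvilleZ P (fun σ => ∏ i ∈ u, linObs (f i) σ) σ := by
  have hQh : ∀ y, HasDerivAt (fun t => ∏ i ∈ u, linObs (f i) (update σ y (t, (σ y).2)))
      (∑ i ∈ u, (∏ j ∈ u.erase i, linObs (f j) σ) * (f i).1 y) (σ y).1 := by
    intro y
    have h := HasDerivAt.fun_finsetProd (fun i (_ : i ∈ u) => hasDerivAt_linObs_lineQ (f i) σ y ((σ y).1))
    simp only [smul_eq_mul, Prod.mk.eta, update_eq_self] at h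
    exact h
  have hPh : ∀ y, HasDerivAt (fun t => ∏ i ∈ u, linObs (f i) (update σ y ((σ y).1, t)))
      (∑ i ∈ u, (∏ j ∈ u.erase i, linObs (f j) σ) * (f i).2 y) (σ y).2 := by
    intro y
    have h := HasDerivAt.fun_finsetProd (fun i (_ : i ∈ u) => hasDerivAt_linObs_lineP (f i) σ y ((σ y).2))
    simp only [smul_eq_mul, Prod.mk.eta, update_eq_self] at h
    exact h
  have hSh : ∀ y ∉ S, (∑ i ∈ u, (∏ j ∈ u.erase i, linObs (f j) σ) * (f i).1 y) = 0 ∧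
      (∑ i ∈ u, (∏ j ∈ u.erase i, linObs (f j) σ) * (f i).2 y) = 0 := by
    intro y hy
    constructor
    · exact Finset.sum_eq_zero fun i hi => by
        rw [(linObs_slopes_eq_zero (f i) (hS i hi) hy).1, mul_zero]
    · exact Finset.sum_eq_zero fun i hi => by
        rw [(linObs_slopes_eq_zero (f i) (hS i hi) hy).2, mul_zero]
  have hSg : ∀ y ∉ S, (0 : ℝ) = 0 ∧ (if y = x then (1 : ℝ) else 0) = 0 := by
    intro y hy
    refine ⟨rfl, ?_⟩
    rw [if_neg]
    rintro rfl
    exact hy hx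
  rw [liouvilleZ_mul_eq P (fun σ => (σ x).2) (fun σ => ∏ i ∈ u, linObs (f i) σ) (fun _ => 0)
    (fun y => if y = x then 1 else 0) _ _ S σ (fun y => hasDerivAt_snd_lineQ σ x y _)
    (fun y => hasDerivAt_snd_lineP σ x y _) hQh hPh hSg hSh, liouvilleZ_momentum]
  ring

/-! ## The registered helper theorem -/

/-- **Registered helper theorem of stub K1 (`stub_harmonicStein`): the Liouville operator of a
product of linear observables** (any chain `P`, any finite `S` containing all supports):
`𝒜 ∏ᵢ φ(fᵢ) = Σᵢ (∏_{j ≠ i} φ(f_j)) · Σ_{y ∈ S} (p_y f_i^q(y) + F_y f_i^p(y))`. [folklore] -/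
theorem harmonicStein_liouvilleProd :
    ∀ (P : OscillatorChain) {ι : Type} [DecidableEq ι] (u : Finset ι) (f : ι → TestFn) (S : Finset ℤ),
      (∀ i ∈ u, (f i).1.support ∪ (f i).2.support ⊆ S) → ∀ σ : ChainConfig,
        liouvilleZ P (fun σ : ChainConfig => ∏ i ∈ u, linObs (f i) σ) σ =
          ∑ i ∈ u, (∏ j ∈ u.erase i, linObs (f j) σ) *
            ∑ y ∈ S, ((σ y).2 * (f i).1 y + P.force σ y * (f i).2 y) :=
  fun P _ _ u f S hS σ => liouvilleZ_prod_linObs P u f S hS σ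

end Summit.AtomisticToContinuum.FouriersLaw.Theorems.DrudeDissolution.GramPencilHarmonicChaos

end
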